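import Mathlib.Topology.Covering.Basic
import HarnessLib

/-!
# Covering maps are stable under pull-back

Topic `Literature/Topology/CoveringSpaces`; theorems only, no definitions. For a covering map
`f : E → X` and a continuous `φ : B → X`, the first projection of the fibre product
`B ×_X E = {(b, e) | φ b = f e}` (a subspace of `B × E`) is a covering map of `B`
(`isCoveringMap_pullback_fst`), evenly covered over `φ⁻¹ U` with the same fibre wherever `f` is
evenly covered over `U` (`isEvenlyCovered_pullback_fst`), and finite-fibred when `f` is
(`finite_preimage_pullback_fst_singleton`). (Hatcher, *Algebraic Topology*, §1.3; tom Dieck,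
*Algebraic Topology*, 3.1.) Mathlib has composition with homeomorphisms
(`IsCoveringMap.comp_homeomorph`, `…homeomorph_comp`) but not this base change.

Used on the complex points of a fibre product of `ℂ`-schemes (`(X ×_S Y)(ℂ) ↪ X(ℂ) × Y(ℂ)` is an
embedding onto this fibre product, `Literature.AlgebraicGeometry.FundamentalGroup.
isEmbedding_map_fst_snd`), e.g. to pull a finite covering of `X(ℂ)` back to a normalisation or a
finite cover `X̃(ℂ)` in the descent step of Riemann's existence theorem (SGA 1 XII 5.1, part 2 a)).

#harness_tags topology.covering_spaces
-/

open Set Topology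

namespace Literature.Topology.CoveringSpaces

universe u v w

variable {B : Type u} {E : Type v} {X : Type w} [TopologicalSpace B] [TopologicalSpace E]
  [TopologicalSpace X] (φ : B → X) (f : E → X)

/-- **Pull-backs of evenly covered points.** If `x = φ b` is evenly covered by `f : E → X` with
fibre `I` and `φ` is continuous, then `b` is evenly covered, with the same fibre, by the projection
`B ×_X E = {(b, e) | φ b = f e} → B`. [folklore] -/
theorem isEvenlyCovered_pullback_fst (hφ : Continuous φ) {I : Type*} [TopologicalSpace I] {b : B}
    (h : IsEvenlyCovered f (φ b) I) :
    IsEvenlyCovered (fun p : {p : B × E // φ p.1 = f p.2} ↦ p.1.1) b I := by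
  obtain ⟨hI, U, hxU, hU, hfU, H, hH⟩ := h
  refine ⟨hI, φ ⁻¹' U, hxU, hU.preimage hφ, ?_, ?_⟩
  · exact (hU.preimage hφ).preimage (continuous_fst.comp continuous_subtype_val)
  -- the trivialisation of the pull-back over `φ⁻¹ U`
  have hmem : ∀ p : {p : B × E // φ p.1 = f p.2}, φ p.1.1 ∈ U → p.1.2 ∈ f ⁻¹' U := by
    intro p hp
    rw [mem_preimage, ← p.2]
    exact hp
  have hsymm : ∀ (u : U) (i : I), f (H.symm (u, i) : E) = u := by
    intro u i
    have := hH (H.symm (u, i))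
    rw [H.apply_symm_apply] at this
    exact this.symm
  refine ⟨{ toFun := fun p ↦ (⟨p.1.1.1, p.2⟩, (H ⟨p.1.1.2, hmem p.1 p.2⟩).2)
            invFun := fun q ↦ ⟨⟨(q.1.1, (H.symm (⟨φ q.1.1, q.1.2⟩, q.2) : E)),
              (hsymm ⟨φ q.1.1, q.1.2⟩ q.2).symm⟩, q.1.2⟩
            left_inv := ?_
            right_inv := ?_
            continuous_toFun := ?_
            continuous_invFun := ?_ }, fun _ ↦ rfl⟩
  · rintro ⟨⟨⟨b', e⟩, hbe⟩, hb'⟩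
    -- `H e = (⟨f e, _⟩, i)` with `f e = φ b'`, so `H.symm (⟨φ b', _⟩, i) = e`
    have h1 : (H ⟨e, hmem ⟨(b', e), hbe⟩ hb'⟩).1 = ⟨φ b', hb'⟩ := by
      apply Subtype.ext
      rw [hH]
      exact hbe.symm
    have h2 : H.symm (⟨φ b', hb'⟩, (H ⟨e, hmem ⟨(b', e), hbe⟩ hb'⟩).2) =
        ⟨e, hmem ⟨(b', e), hbe⟩ hb'⟩ := by
      rw [← h1, Prod.mk.eta, H.symm_apply_apply]
    ext
    · rfl
    · exact congrArg Subtype.val h2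
  · rintro ⟨⟨b', hb'⟩, i⟩
    dsimp only
    have : (⟨(H.symm (⟨φ b', hb'⟩, i) : E), hmem ⟨(b', (H.symm (⟨φ b', hb'⟩, i) : E)),
        (hsymm ⟨φ b', hb'⟩ i).symm⟩ hb'⟩ : f ⁻¹' U) = H.symm (⟨φ b', hb'⟩, i) := rfl
    rw [this, H.apply_symm_apply]
  · refine Continuous.prodMk (by fun_prop) ?_
    exact continuous_snd.comp (H.continuous.comp (by fun_prop))
  · refine Continuous.subtype_mk (Continuous.subtype_mk (Continuous.prodMk (by fun_prop) ?_) _) _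
    exact continuous_subtype_val.comp (H.symm.continuous.comp (by fun_prop))

/-- **Covering maps are stable under pull-back**: if `f : E → X` is a covering map and
`φ : B → X` is continuous, the projection `B ×_X E → B` is a covering map. [folklore] -/
theorem isCoveringMap_pullback_fst (hφ : Continuous φ) (hf : IsCoveringMap f) :
    IsCoveringMap (fun p : {p : B × E // φ p.1 = f p.2} ↦ p.1.1) := fun b ↦
  (isEvenlyCovered_pullback_fst φ f hφ (hf (φ b))).to_isEvenlyCovered_preimage

omit [TopologicalSpace B] [TopologicalSpace E] [TopologicalSpace X] in
/-- Pull-backs of finite-fibred maps are finite-fibred. [folklore] -/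
theorem finite_preimage_pullback_fst_singleton (hfin : ∀ x, (f ⁻¹' {x}).Finite) (b : B) :
    ((fun p : {p : B × E // φ p.1 = f p.2} ↦ p.1.1) ⁻¹' {b}).Finite := by
  haveI := (hfin (φ b)).to_subtype
  -- `p ↦ p.2` injects the fibre over `b` into the fibre of `f` over `φ b`
  let ι : (fun p : {p : B × E // φ p.1 = f p.2} ↦ p.1.1) ⁻¹' {b} → f ⁻¹' {φ b} := fun p ↦
    ⟨p.1.1.2, by
      have h1 : p.1.1.1 = b := p.2
      rw [mem_preimage, mem_singleton_iff, ← p.1.2, h1]⟩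
  refine Set.finite_coe_iff.mp (Finite.of_injective ι ?_)
  rintro ⟨⟨⟨b₁, e₁⟩, h₁⟩, hb₁⟩ ⟨⟨⟨b₂, e₂⟩, h₂⟩, hb₂⟩ h
  change b₁ = b at hb₁
  change b₂ = b at hb₂
  have he : e₁ = e₂ := congrArg Subtype.val h
  subst hb₁ hb₂ he
  rfl

end Literature.Topology.CoveringSpaces
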